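import Mathlib.LinearAlgebra.FreeModule.Basic
import Mathlib.LinearAlgebra.Projection
import Literature.NumberTheory.GaloisCohomology.PBasisKoszulIdentities
import HarnessLib

/-!
# `Ωⁿ⁺¹ = Bⁿ⁺¹ ⊕ ker hₙ`: the forms modulo the exact forms are free

Let `R` be a ring of characteristic `p` with a finite `p`-basis `t : ι → R` (`ι` linearly ordered), and let
`h = IsPBasis.hTwist`, `π = IsPBasis.πTwist` be the Koszul contraction and the Cartier projector on the
Frobenius-twisted de Rham complex `(Ωⁿ_R, d = dTwist p R n)` (`PBasisKoszulOperators.lean`), which satisfy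
`dh + hd = 1 - π` (`PBasisKoszulHomotopy.lean`) and the side conditions `h² = 0`, `hπ = 0`, `dhd = d`
(`PBasisKoszulIdentities.lean`).  This file draws the consequences for the EXACT forms
`Bⁿ⁺¹ = exactTwist p R (n + 1) = im dₙ` (an `R`-submodule of `Ωⁿ⁺¹_R` through Frobenius, `c • ω = c^p ω`):

* `isCompl_exactTwist_ker_hTwist`: **`Ωⁿ⁺¹ = Bⁿ⁺¹ ⊕ ker hₙ`** — `B ∩ ker h = 0` since `x = d y`, `h x = 0`
  give `x = d h d y = d h x = 0`; `B + ker h = Ω` since `x = d (h x) + (h (d x) + π x)` and `h` kills both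
  `h (d x)` (`h² = 0`) and `π x` (`hπ = 0`);
* `quotExactTwistEquivKerHTwist`: hence `Ωⁿ⁺¹ ⧸ Bⁿ⁺¹ ≃ₗ[R] ker hₙ`;
* `ker_hTwist_eq_span`: **`ker hₙ` is spanned by the monomial basis vectors `E (α, s) = t^α • dt_s` that `h`
  kills** (`hVec n (α, s) = 0`; by `hVec_eq_zero_iff` these are exactly the pairs NOT of "type A", type A
  meaning that the live set `live α s` is nonempty with minimum in `s`); as a sub-family of a basis they form
  the basis `kerHTwistBasis` of `ker hₙ` (`free_ker_hTwist`);
* **`free_quot_exactTwist`: `Ωⁿ⁺¹ ⧸ Bⁿ⁺¹` is a free `R`-module**, with the explicit basis `quotExactTwistBasis`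
  of classes of monomial vectors; in degree `0`, `exactTwist_zero : B⁰ = 0` and `free_quot_exactTwist_zero`.

The freeness of `Ω/B` (with that of `H = Z/B`, `CartierStructure.lean`) is the flatness input of the purity
theorems for logarithmic Hodge–Witt sheaves (Gros–Suwa) and for Kato's cohomology in characteristic `p`.
Not in this file: bases of `Bⁿ` and `Zⁿ` themselves, and the Cartier operator.

## References

* L. Illusie, *Complexe de de Rham–Witt et cohomologie cristalline*, Ann. Sci. ÉNS 12 (1979), 0.2
  (structure of the de Rham complex in characteristic `p` via the weight grading). [Illusie1979]
-/

noncomputable section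

open scoped BigOperators
open Literature.AlgebraicGeometry.Crystalline (insertSign)

namespace Literature.NumberTheory.GaloisCohomology

universe u v

/-! ### Degree `0`: there are no exact `0`-forms -/

section DegreeZero

variable (p : ℕ) [hp : Fact p.Prime] (R : Type u) [CommRing R] [CharP R p]

/-- **`B⁰ = 0`**: the twisted exact `0`-forms are the zero submodule. [folklore] -/
theorem exactTwist_zero : exactTwist p R 0 = ⊥ := by
  ext x
  rw [mem_exactTwist_iff, exactForms_zero, AddSubgroup.mem_bot, Submodule.mem_bot]
  exact (FrobeniusTwist.of p R (M := ⋀[R]^0 (Ω[R⁄ℤ]))).symm.map_eq_zero_iff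

end DegreeZero

namespace IsPBasis

open DeRhamWeights

variable {p : ℕ} [hp : Fact p.Prime] {R : Type u} [CommRing R] [CharP R p] {ι : Type v} [Fintype ι]
  [LinearOrder ι] {t : ι → R} (h : IsPBasis p t)

/-! ### `Ωⁿ⁺¹ = Bⁿ⁺¹ ⊕ ker hₙ` -/

/-- **`Bⁿ⁺¹ ∩ ker hₙ = 0`**: an exact form killed by the Koszul contraction vanishes
(`x = d y = d h d y = d h x = 0`, by `dhd = d`). [cite: Illusie1979, 0.2] -/
theorem disjoint_exactTwist_ker_hTwist (n : ℕ) :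
    Disjoint (exactTwist p R (n + 1)) (LinearMap.ker (h.hTwist n)) := by
  rw [Submodule.disjoint_def]
  intro x hx hker
  rw [← range_dTwist, LinearMap.mem_range] at hx
  obtain ⟨y, rfl⟩ := hx
  rw [LinearMap.mem_ker] at hker
  rw [← h.dTwist_hTwist_dTwist n y, hker, map_zero]

/-- **`Bⁿ⁺¹ + ker hₙ = Ωⁿ⁺¹`**: `x = d (h x) + (h (d x) + π x)` with `h (h (d x)) = 0 = h (π x)`.
[cite: Illusie1979, 0.2] -/
theorem codisjoint_exactTwist_ker_hTwist (n : ℕ) :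
    Codisjoint (exactTwist p R (n + 1)) (LinearMap.ker (h.hTwist n)) := by
  rw [codisjoint_iff, Submodule.eq_top_iff']
  intro x
  rw [h.eq_dh_add_hd_add_π n x, add_assoc]
  refine Submodule.add_mem_sup ?_ ?_
  · rw [← range_dTwist]
    exact LinearMap.mem_range_self _ _
  · rw [LinearMap.mem_ker, map_add, h.hTwist_hTwist, h.hTwist_πTwist, add_zero]

/-- **`Ωⁿ⁺¹ = Bⁿ⁺¹ ⊕ ker hₙ`**: the kernel of the Koszul contraction is a complement of the exact forms.
[cite: Illusie1979, 0.2] -/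
theorem isCompl_exactTwist_ker_hTwist (n : ℕ) :
    IsCompl (exactTwist p R (n + 1)) (LinearMap.ker (h.hTwist n)) :=
  ⟨h.disjoint_exactTwist_ker_hTwist n, h.codisjoint_exactTwist_ker_hTwist n⟩

/-- **`Ωⁿ⁺¹ ⧸ Bⁿ⁺¹ ≃ₗ[R] ker hₙ`** (class of `x` ↦ its component in `ker hₙ`; inverse: `y ↦ [y]`).
[cite: Illusie1979, 0.2] -/
def quotExactTwistEquivKerHTwist (n : ℕ) :
    (FrobeniusTwist p R (⋀[R]^(n + 1) (Ω[R⁄ℤ])) ⧸ exactTwist p R (n + 1)) ≃ₗ[R]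
      LinearMap.ker (h.hTwist n) :=
  Submodule.quotientEquivOfIsCompl _ _ (h.isCompl_exactTwist_ker_hTwist n)

/-- The inverse of `quotExactTwistEquivKerHTwist` is the class map. [folklore] -/
@[simp] theorem quotExactTwistEquivKerHTwist_symm_apply (n : ℕ) (y : LinearMap.ker (h.hTwist n)) :
    (h.quotExactTwistEquivKerHTwist n).symm y =
      Submodule.Quotient.mk (y : FrobeniusTwist p R (⋀[R]^(n + 1) (Ω[R⁄ℤ]))) :=
  rfl

/-- A form killed by `hₙ` is `h (d x) + π x`. [folklore] -/
theorem eq_hd_add_π_of_hTwist_eq_zero (n : ℕ) {x : FrobeniusTwist p R (⋀[R]^(n + 1) (Ω[R⁄ℤ]))}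
    (hx : h.hTwist n x = 0) : x = h.hTwist (n + 1) (dTwist p R (n + 1) x) + h.πTwist (n + 1) x := by
  conv_lhs => rw [h.eq_dh_add_hd_add_π n x, hx, map_zero, zero_add]

/-! ### Which monomial vectors are killed by `h` -/

/-- **`h` kills `E (α, s)` iff `(α, s)` is not of type A** (type A: the live set is nonempty and its minimum
`i₀` lies in `s`).  In the type-A case `h (E (α, s)) = (w⁻¹ ε) • E (α + e_{i₀}, s ∖ i₀)` with `w⁻¹ ε`
invertible modulo `p`, hence nonzero on a basis vector. [folklore] -/
theorem hVec_eq_zero_iff (n : ℕ) (α : ι → Fin p) (s : Set.powersetCard ι (n + 1)) :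
    h.hVec n (α, s) = 0 ↔
      ¬ ∃ hl : (live α (s : Finset ι)).Nonempty, (live α (s : Finset ι)).min' hl ∈ (s : Finset ι) := by
  constructor
  · rintro h0 ⟨hl, hi₀⟩
    rw [h.hVec_of_min_mem n hl rfl hi₀] at h0
    have hw := mem_live_iff.1 (Finset.min'_mem _ hl)
    have key := invWt_mul_modEq p hw.1 hw.2
    haveI : Nontrivial R := CharP.nontrivial_of_char_ne_one hp.out.ne_one
    refine (h.twistFormBasis n).ne_zero
      (α + Pi.single ((live α (s : Finset ι)).min' hl) 1, eraseIdx s _ hi₀) ?_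
    rw [← zsmul_eq_self_of_modEq_one (R := R) key (h.twistFormBasis n _)]
    have hεε := coe_insertSign_mul_self ((s : Finset ι).erase ((live α (s : Finset ι)).min' hl))
      ((live α (s : Finset ι)).min' hl)
    have hc : invWt p (wt α (s : Finset ι) ((live α (s : Finset ι)).min' hl)) *
          ((wt α (s : Finset ι) ((live α (s : Finset ι)).min' hl) : ℕ) : ℤ) =
        (((wt α (s : Finset ι) ((live α (s : Finset ι)).min' hl) : ℕ) : ℤ) *
            ((insertSign ((s : Finset ι).erase ((live α (s : Finset ι)).min' hl))
              ((live α (s : Finset ι)).min' hl) : ℤˣ) : ℤ)) *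
          (invWt p (wt α (s : Finset ι) ((live α (s : Finset ι)).min' hl)) *
            ((insertSign ((s : Finset ι).erase ((live α (s : Finset ι)).min' hl))
              ((live α (s : Finset ι)).min' hl) : ℤˣ) : ℤ)) := by
      calc _ = invWt p (wt α (s : Finset ι) ((live α (s : Finset ι)).min' hl)) *
            ((wt α (s : Finset ι) ((live α (s : Finset ι)).min' hl) : ℕ) : ℤ) *
            (((insertSign ((s : Finset ι).erase ((live α (s : Finset ι)).min' hl))
              ((live α (s : Finset ι)).min' hl) : ℤˣ) : ℤ) *
              ((insertSign ((s : Finset ι).erase ((live α (s : Finset ι)).min' hl))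
                ((live α (s : Finset ι)).min' hl) : ℤˣ) : ℤ)) := by rw [hεε, mul_one]
        _ = _ := by ring
    rw [hc, mul_smul, h0, smul_zero]
  · intro hA
    by_cases hl : (live α (s : Finset ι)).Nonempty
    · exact h.hVec_of_min_not_mem n hl rfl fun hi₀ => hA ⟨hl, hi₀⟩
    · exact h.hVec_of_live_eq_empty n (Finset.not_nonempty_iff_eq_empty.1 hl)

/-- The target of the h-move of a type-A pair of degree `n + 2` is killed by `hₙ` (its live set is the same,
with minimum `i₀ ∉ s ∖ i₀`). [folklore] -/
theorem hVec_hMove (n : ℕ) (α : ι → Fin p) (s : Set.powersetCard ι (n + 2))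
    (hl : (live α (s : Finset ι)).Nonempty) (hi₀ : (live α (s : Finset ι)).min' hl ∈ (s : Finset ι)) :
    h.hVec n (α + Pi.single ((live α (s : Finset ι)).min' hl) 1, eraseIdx s _ hi₀) = 0 :=
  (h.πVec_hMove_eq_zero_and_hVec_hMove_eq_zero n α s hl rfl hi₀).2

/-! ### `ker hₙ` is spanned by the monomial vectors killed by `h` -/

/-- **The monomial vectors of `ker hₙ`**: the basis vectors `E (α, s) = t^α • dt_s` of degree `n + 1` killed
by the Koszul contraction (`hVec n (α, s) = 0`, i.e. `(α, s)` not of type A, `hVec_eq_zero_iff`), as a family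
indexed by the corresponding subtype. [cite: Illusie1979, 0.2] -/
def kerHTwistVec (n : ℕ) (αs : {αs : (ι → Fin p) × Set.powersetCard ι (n + 1) // h.hVec n αs = 0}) :
    FrobeniusTwist p R (⋀[R]^(n + 1) (Ω[R⁄ℤ])) :=
  h.twistFormBasis (n + 1) αs.1

/-- `kerHTwistVec` unfolds to the monomial basis vector. [folklore] -/
@[simp] theorem kerHTwistVec_apply (n : ℕ)
    (αs : {αs : (ι → Fin p) × Set.powersetCard ι (n + 1) // h.hVec n αs = 0}) :
    h.kerHTwistVec n αs = h.twistFormBasis (n + 1) αs.1 :=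
  rfl

/-- Each `kerHTwistVec` lies in `ker hₙ`. [folklore] -/
theorem hTwist_kerHTwistVec (n : ℕ)
    (αs : {αs : (ι → Fin p) × Set.powersetCard ι (n + 1) // h.hVec n αs = 0}) :
    h.hTwist n (h.kerHTwistVec n αs) = 0 := by
  rw [kerHTwistVec_apply, hTwist_basis, αs.2]

/-- The family `kerHTwistVec` is linearly independent (a sub-family of the monomial basis). [folklore] -/
theorem linearIndependent_kerHTwistVec (n : ℕ) : LinearIndependent R (h.kerHTwistVec n) :=
  (h.twistFormBasis (n + 1)).linearIndependent.comp _ Subtype.val_injective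

/-- `h (E (α, s))` (degree `n + 2 → n + 1`) lies in the span of the monomial vectors killed by `hₙ`: it is `0`
or a multiple of the h-move target, which `hₙ` kills (`hVec_hMove`; this is `h² = 0`). [folklore] -/
theorem hVec_mem_span_kerHTwistVec (n : ℕ) (αs : (ι → Fin p) × Set.powersetCard ι (n + 2)) :
    h.hVec (n + 1) αs ∈ Submodule.span R (Set.range (h.kerHTwistVec n)) := by
  obtain ⟨α, s⟩ := αs
  by_cases hl : (live α (s : Finset ι)).Nonempty
  · by_cases hi₀ : (live α (s : Finset ι)).min' hl ∈ (s : Finset ι)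
    · rw [h.hVec_of_min_mem (n + 1) hl rfl hi₀]
      refine zsmul_mem ?_ _
      exact Submodule.subset_span ⟨⟨_, h.hVec_hMove n α s hl hi₀⟩, rfl⟩
    · rw [h.hVec_of_min_not_mem (n + 1) hl rfl hi₀]
      exact Submodule.zero_mem _
  · rw [h.hVec_of_live_eq_empty (n + 1) (Finset.not_nonempty_iff_eq_empty.1 hl)]
    exact Submodule.zero_mem _

/-- **`im hₙ₊₁ ≤ span (kerHTwistVec n)`.** [folklore] -/
theorem range_hTwist_le_span_kerHTwistVec (n : ℕ) :
    LinearMap.range (h.hTwist (n + 1)) ≤ Submodule.span R (Set.range (h.kerHTwistVec n)) := by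
  rw [hTwist, Module.Basis.constr_range, Submodule.span_le]
  rintro _ ⟨αs, rfl⟩
  exact h.hVec_mem_span_kerHTwistVec n αs

/-- `π (E (α, s))` (degree `n + 1`) lies in the span of the monomial vectors killed by `hₙ`: a Cartier vector
has no live index, so `h` kills it. [folklore] -/
theorem πVec_mem_span_kerHTwistVec (n : ℕ) (αs : (ι → Fin p) × Set.powersetCard ι (n + 1)) :
    h.πVec (n + 1) αs ∈ Submodule.span R (Set.range (h.kerHTwistVec n)) := by
  obtain ⟨α, s⟩ := αs
  by_cases hl : live α (s : Finset ι) = ∅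
  · rw [h.πVec_of_live_eq_empty (n + 1) hl]
    exact Submodule.subset_span ⟨⟨(α, s), h.hVec_of_live_eq_empty n hl⟩, rfl⟩
  · rw [h.πVec_of_live_nonempty (n + 1) (Finset.nonempty_iff_ne_empty.2 hl)]
    exact Submodule.zero_mem _

/-- **`im πₙ₊₁ ≤ span (kerHTwistVec n)`.** [folklore] -/
theorem range_πTwist_le_span_kerHTwistVec (n : ℕ) :
    LinearMap.range (h.πTwist (n + 1)) ≤ Submodule.span R (Set.range (h.kerHTwistVec n)) := by
  rw [πTwist, Module.Basis.constr_range, Submodule.span_le]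
  rintro _ ⟨αs, rfl⟩
  exact h.πVec_mem_span_kerHTwistVec n αs

/-- **`ker hₙ` is the span of the monomial vectors killed by `h`**: `⊇` is clear, and a form `x` with
`h x = 0` is `x = h (d x) + π x ∈ im h + im π`. [cite: Illusie1979, 0.2] -/
theorem ker_hTwist_eq_span (n : ℕ) :
    LinearMap.ker (h.hTwist n) = Submodule.span R (Set.range (h.kerHTwistVec n)) := by
  apply le_antisymm
  · intro x hx
    rw [LinearMap.mem_ker] at hx
    rw [h.eq_hd_add_π_of_hTwist_eq_zero n hx]
    exact Submodule.add_mem _ (h.range_hTwist_le_span_kerHTwistVec n (LinearMap.mem_range_self _ _))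
      (h.range_πTwist_le_span_kerHTwistVec n (LinearMap.mem_range_self _ _))
  · rw [Submodule.span_le]
    rintro _ ⟨αs, rfl⟩
    exact LinearMap.mem_ker.2 (h.hTwist_kerHTwistVec n αs)

/-- **The basis of `ker hₙ` by the monomial vectors killed by `h`.** [cite: Illusie1979, 0.2] -/
def kerHTwistBasis (n : ℕ) :
    Module.Basis {αs : (ι → Fin p) × Set.powersetCard ι (n + 1) // h.hVec n αs = 0} R
      (LinearMap.ker (h.hTwist n)) :=
  (Module.Basis.span (h.linearIndependent_kerHTwistVec n)).map
    (LinearEquiv.ofEq _ _ (h.ker_hTwist_eq_span n).symm)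

/-- The vectors of `kerHTwistBasis` are the monomial vectors. [folklore] -/
@[simp] theorem coe_kerHTwistBasis_apply (n : ℕ)
    (αs : {αs : (ι → Fin p) × Set.powersetCard ι (n + 1) // h.hVec n αs = 0}) :
    (h.kerHTwistBasis n αs : FrobeniusTwist p R (⋀[R]^(n + 1) (Ω[R⁄ℤ]))) = h.twistFormBasis (n + 1) αs.1 := by
  rw [kerHTwistBasis, Module.Basis.map_apply, Module.Basis.span_apply]
  rfl

/-- **`ker hₙ` is a free `R`-module.** [folklore] -/
theorem free_ker_hTwist (n : ℕ) : Module.Free R (LinearMap.ker (h.hTwist n)) :=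
  Module.Free.of_basis (h.kerHTwistBasis n)

/-! ### `Ωⁿ⁺¹ ⧸ Bⁿ⁺¹` is free -/

/-- **The basis of `Ωⁿ⁺¹ ⧸ Bⁿ⁺¹` by the classes of the monomial vectors `t^α • dt_s` not of type A.**
[cite: Illusie1979, 0.2] -/
def quotExactTwistBasis (n : ℕ) :
    Module.Basis {αs : (ι → Fin p) × Set.powersetCard ι (n + 1) // h.hVec n αs = 0} R
      (FrobeniusTwist p R (⋀[R]^(n + 1) (Ω[R⁄ℤ])) ⧸ exactTwist p R (n + 1)) :=
  (h.kerHTwistBasis n).map (h.quotExactTwistEquivKerHTwist n).symm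

/-- The vectors of `quotExactTwistBasis` are the classes `[t^α • dt_s]`. [folklore] -/
theorem quotExactTwistBasis_apply (n : ℕ)
    (αs : {αs : (ι → Fin p) × Set.powersetCard ι (n + 1) // h.hVec n αs = 0}) :
    h.quotExactTwistBasis n αs = Submodule.Quotient.mk (h.twistFormBasis (n + 1) αs.1) := by
  rw [quotExactTwistBasis, Module.Basis.map_apply, quotExactTwistEquivKerHTwist_symm_apply,
    coe_kerHTwistBasis_apply]

include h in
/-- **`Ωⁿ⁺¹ ⧸ Bⁿ⁺¹` is a free `R`-module (through Frobenius)** for a ring with a finite `p`-basis — the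
freeness of "forms modulo exact forms" used in the purity theorems of Gros–Suwa and Kato. [cite: Illusie1979, 0.2] -/
theorem free_quot_exactTwist (n : ℕ) :
    Module.Free R (FrobeniusTwist p R (⋀[R]^(n + 1) (Ω[R⁄ℤ])) ⧸ exactTwist p R (n + 1)) :=
  Module.Free.of_basis (h.quotExactTwistBasis n)

include h in
/-- The twisted forms `Ωⁿ` themselves are free (monomial basis). [folklore] -/
theorem free_twistForms (n : ℕ) : Module.Free R (FrobeniusTwist p R (⋀[R]^n (Ω[R⁄ℤ]))) :=
  Module.Free.of_basis (h.twistFormBasis n)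

/-- **`Ω⁰ ⧸ B⁰ = Ω⁰`**: the basis of `Ω⁰ ⧸ B⁰` by the classes of all monomial vectors. [folklore] -/
def quotExactTwistZeroBasis :
    Module.Basis ((ι → Fin p) × Set.powersetCard ι 0) R
      (FrobeniusTwist p R (⋀[R]^0 (Ω[R⁄ℤ])) ⧸ exactTwist p R 0) :=
  (h.twistFormBasis 0).map (Submodule.quotEquivOfEqBot _ (exactTwist_zero p R)).symm

include h in
/-- `Ω⁰ ⧸ B⁰` is a free `R`-module. [folklore] -/
theorem free_quot_exactTwist_zero : Module.Free R (FrobeniusTwist p R (⋀[R]^0 (Ω[R⁄ℤ])) ⧸ exactTwist p R 0) :=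
  Module.Free.of_basis h.quotExactTwistZeroBasis

end IsPBasis

end Literature.NumberTheory.GaloisCohomology

end
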